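import Mathlib.Analysis.Calculus.ParametricIntegral
import Mathlib.Analysis.Calculus.ContDiff.FiniteDimension
import Mathlib.Analysis.Calculus.LineDeriv.Basic
import Mathlib.Analysis.InnerProductSpace.PiL2
import Mathlib.MeasureTheory.Integral.DominatedConvergence
import Mathlib.MeasureTheory.Integral.Bochner.ContinuousLinearMap
import HarnessLib

/-!
# Iterated differentiation under the integral sign with integrable (possibly singular) bounds,
# and joint measurability of spatial derivatives of measurable families of smooth functions

Analysis/FunctionSpaces support file (all results proved; no named facts). It serves the
regularity bootstrap for bounded ("drift-mild") solutions of the Navier–Stokes equations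
(Koch–Nadirashvili–Seregin–Šverák 2009, §4; `FluidPDE/DriftMildBootstrap`), where the Duhamel
term `B(x) = ∫ₛᵗ N_{t−τ}[u(τ), u(τ)](x) dτ` is differentiated `k + 1` times under the time
integral: each slice `N_{t−τ}[u(τ), u(τ)]` is smooth in `x`, but its derivatives blow up as
`τ → t` and are only *measurable* in `τ`, with **integrable** bounds `(t − τ)^{-1/2}` (orders `≤ k`)
and `(t − τ)^{-1+α/2}` (order `k + 1`), and none beyond. The tree's parametric-integral files
`SmoothParametricIntegral`, `ParametricIntegralSmooth` treat integrands jointly smooth in the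
parameter and the integration variable over compact sets, and `SmoothParametricIntegralDominated`
the `C^∞` case under local domination of *every* order with the measurability of the parameter
derivatives assumed; here the order is finite (`Cᵐ` from bounds on the orders `≤ m` only, which is
all a Duhamel integrand affords), the integration variable enters only measurably, and the
measurability of the derivatives is proved. Two generic statements (any measure space `Ω`, finite-dimensional inner product
space `E` of parameters, Banach space `F` of values):

* `stronglyMeasurable_fderiv_param`, `stronglyMeasurable_iteratedFDeriv_param`: if
  `(w, x) ↦ W w x` is (jointly) strongly measurable and every `W w` is smooth, then
  `(w, x) ↦ Dⁱ(W w)(x)` is strongly measurable for every `i` — derivatives are pointwise limits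
  of difference quotients (`hasLineDerivAt_iff_tendsto_slope_zero`), assembled over an
  orthonormal frame, and `Dⁱ⁺¹ = curry⁻¹ ∘ D(Dⁱ)`. (Mathlib's `measurable_fderiv_with_param` needs
  joint *continuity*.)
* `contDiff_integral_of_dominated_iteratedFDeriv`: if moreover `‖Dⁱ(N w)(x)‖ ≤ bᵢ(w)` with
  `bᵢ` integrable for all `i ≤ m`, then `x ↦ ∫ N w x dμ` is `Cᵐ` and
  `Dʲ(∫ N w · dμ)(x) = ∫ Dʲ(N w)(x) dμ` for `j ≤ m` (Mathlib's
  `hasFDerivAt_integral_of_dominated_of_fderiv_le` iterated along `Dʲ⁺¹ = curry⁻¹ ∘ D(Dʲ)`, the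
  top order by dominated continuity); with the consequences `norm_iteratedFDeriv_integral_le`
  and `norm_iteratedFDeriv_integral_sub_le` (sup bounds and increments pass under the integral).

## References

* L. Hörmander, *The Analysis of Linear Partial Differential Operators I*, 2nd ed. (1990),
  Thm. 1.1.7–1.1.9 (differentiation under the integral sign). [folklore]
* G. Koch, N. Nadirashvili, G. Seregin, V. Šverák, Acta Math. 203 (2009) = arXiv:0709.3599,
  §4 (the use made of it). [KochNadirashviliSereginSverak2009]
-/

noncomputable section

open MeasureTheory Set Function Filter Metric
open scoped Topology ContDiff

namespace Literature.Analysis.FunctionSpaces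

variable {Ω : Type*} [MeasurableSpace Ω]
variable {E : Type*} [NormedAddCommGroup E] [InnerProductSpace ℝ E] [FiniteDimensional ℝ E]
  [MeasurableSpace E] [BorelSpace E]
variable {F : Type*} [NormedAddCommGroup F] [NormedSpace ℝ F]

/-! ### Joint measurability of spatial derivatives -/

section Measurability

omit [FiniteDimensional ℝ E] in
/-- **Directional derivatives of a measurable family of differentiable functions are jointly
strongly measurable**: `(w, x) ↦ D(W w)(x) v` is the pointwise limit of the jointly measurable
difference quotients `(n+1) • (W w (x + (n+1)⁻¹v) − W w x)`. [folklore] -/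
theorem stronglyMeasurable_fderiv_apply_param {W : Ω → E → F}
    (hW : StronglyMeasurable (uncurry W)) (hd : ∀ w x, DifferentiableAt ℝ (W w) x) (v : E) :
    StronglyMeasurable (fun q : Ω × E => fderiv ℝ (W q.1) q.2 v) := by
  set f : ℕ → Ω × E → F := fun n q =>
    ((n : ℝ) + 1) • (W q.1 (q.2 + ((n : ℝ) + 1)⁻¹ • v) - W q.1 q.2) with hf
  have hfm : ∀ n, StronglyMeasurable (f n) := fun n => by
    have h1 : StronglyMeasurable (fun q : Ω × E => W q.1 (q.2 + ((n : ℝ) + 1)⁻¹ • v)) :=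
      hW.comp_measurable (measurable_fst.prodMk (measurable_snd.add_const _))
    have h2 : StronglyMeasurable (fun q : Ω × E => W q.1 q.2) :=
      hW.comp_measurable (measurable_fst.prodMk measurable_snd)
    exact (h1.sub h2).const_smul _
  refine stronglyMeasurable_of_tendsto (u := atTop) hfm ?_
  rw [tendsto_pi_nhds]
  intro q
  have hline : HasLineDerivAt ℝ (W q.1) (fderiv ℝ (W q.1) q.2 v) q.2 v :=
    (hd q.1 q.2).hasFDerivAt.hasLineDerivAt v
  have hslope := (hasLineDerivAt_iff_tendsto_slope_zero.1 hline)
  have hseq : Tendsto (fun n : ℕ => ((n : ℝ) + 1)⁻¹) atTop (𝓝[≠] (0 : ℝ)) := by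
    refine tendsto_nhdsWithin_iff.2 ⟨?_, Eventually.of_forall fun n => ?_⟩
    · have h := tendsto_one_div_add_atTop_nhds_zero_nat (𝕜 := ℝ)
      simpa only [one_div] using h
    · exact inv_ne_zero (by positivity)
  have := hslope.comp hseq
  refine this.congr fun n => ?_
  simp only [hf, Function.comp_apply, inv_inv]

/-- **The derivative of a measurable family of differentiable functions is jointly strongly
measurable** (operator-valued): expand `D(W w)(x) = ∑ᵢ ⟪eᵢ, ·⟫ • D(W w)(x) eᵢ` over an orthonormal
frame and use `stronglyMeasurable_fderiv_apply_param`. [folklore] -/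
theorem stronglyMeasurable_fderiv_param {W : Ω → E → F}
    (hW : StronglyMeasurable (uncurry W)) (hd : ∀ w x, DifferentiableAt ℝ (W w) x) :
    StronglyMeasurable (fun q : Ω × E => fderiv ℝ (W q.1) q.2) := by
  set e := stdOrthonormalBasis ℝ E with he
  have hrepr : ∀ T : E →L[ℝ] F,
      T = ∑ i, (innerSL ℝ (e i)).smulRight (T (e i)) := fun T => by
    ext w
    simp only [FunLike.coe_sum, Finset.sum_apply,
      ContinuousLinearMap.smulRight_apply, innerSL_apply_apply]
    conv_lhs => rw [← e.sum_repr' w]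
    simp only [map_sum, map_smul]
  have hfun : (fun q : Ω × E => fderiv ℝ (W q.1) q.2) =
      fun q => ∑ i, (innerSL ℝ (e i)).smulRight (fderiv ℝ (W q.1) q.2 (e i)) :=
    funext fun q => hrepr _
  rw [hfun]
  have hterm : ∀ i, StronglyMeasurable
      (fun q : Ω × E => (innerSL ℝ (e i)).smulRight (fderiv ℝ (W q.1) q.2 (e i))) := fun i =>
    (ContinuousLinearMap.smulRightL ℝ E F (innerSL ℝ (e i))).continuous.comp_stronglyMeasurable
      (stronglyMeasurable_fderiv_apply_param hW hd (e i))
  exact Finset.stronglyMeasurable_fun_sum Finset.univ fun i _ => hterm i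

/-- **All spatial derivatives of a measurable family of smooth functions are jointly strongly
measurable**: `(w, x) ↦ Dⁱ(W w)(x)` for every `i` (induction via `Dⁱ⁺¹ = curry⁻¹ ∘ D(Dⁱ)`). [folklore] -/
theorem stronglyMeasurable_iteratedFDeriv_param {W : Ω → E → F}
    (hW : StronglyMeasurable (uncurry W)) (hs : ∀ w, ContDiff ℝ ∞ (W w)) (i : ℕ) :
    StronglyMeasurable (fun q : Ω × E => iteratedFDeriv ℝ i (W q.1) q.2) := by
  induction i with
  | zero =>
    have : (fun q : Ω × E => iteratedFDeriv ℝ 0 (W q.1) q.2) =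
        fun q => (continuousMultilinearCurryFin0 ℝ E F).symm (uncurry W q) := by
      funext q; rfl
    rw [this]
    exact (continuousMultilinearCurryFin0 ℝ E F).symm.continuous.comp_stronglyMeasurable hW
  | succ i ih =>
    have hd : ∀ w x, DifferentiableAt ℝ (fun y => iteratedFDeriv ℝ i (W w) y) x := fun w x =>
      ((hs w).differentiable_iteratedFDeriv (m := i) (by exact_mod_cast ENat.coe_lt_top i)) x
    have h := stronglyMeasurable_fderiv_param (W := fun w x => iteratedFDeriv ℝ i (W w) x) ih hd
    have : (fun q : Ω × E => iteratedFDeriv ℝ (i + 1) (W q.1) q.2) = fun q =>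
        (continuousMultilinearCurryLeftEquiv ℝ (fun _ : Fin (i + 1) => E) F).symm
          (fderiv ℝ (iteratedFDeriv ℝ i (W q.1)) q.2) := by
      funext q; rfl
    rw [this]
    exact (continuousMultilinearCurryLeftEquiv ℝ (fun _ : Fin (i + 1) => E) F).symm.continuous
      |>.comp_stronglyMeasurable h

end Measurability

/-! ### Iterated differentiation under the integral sign -/

section Dominated

variable [CompleteSpace F] {μ : Measure Ω}

/-- **Iterated differentiation under the integral sign with integrable bounds** (Hörmander,
Thm. 1.1.9, in the form needed for Duhamel integrals with singular but integrable derivative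
bounds): let `N : Ω → E → F` be jointly strongly measurable with every `N w` smooth, and suppose
`‖Dⁱ(N w)(x)‖ ≤ bᵢ(w)` for all `x`, with `bᵢ` integrable, for every `i ≤ m`. Then
`x ↦ ∫ N w x dμ` is `Cᵐ` and `Dʲ(∫ N w · dμ)(x) = ∫ Dʲ(N w)(x) dμ` for all `j ≤ m`. Proof: with
`Bᵢ(x) = ∫ Dⁱ(N w)(x) dμ`, dominated differentiation gives `DBᵢ = curry ∘ Bᵢ₊₁` (`i < m`) and
dominated convergence the continuity of `B_m`; then `Bᵢ ∈ C^{m−i}` by downward induction and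
`Dʲ(∫N) = Bⱼ` by `Dʲ⁺¹ = curry⁻¹ ∘ D(Dʲ)`. [folklore] -/
theorem contDiff_integral_of_dominated_iteratedFDeriv {N : Ω → E → F} {m : ℕ}
    (hN : StronglyMeasurable (uncurry N)) (hs : ∀ w, ContDiff ℝ ∞ (N w))
    {bound : ℕ → Ω → ℝ} (hbi : ∀ i ≤ m, Integrable (bound i) μ)
    (hb : ∀ i ≤ m, ∀ w x, ‖iteratedFDeriv ℝ i (N w) x‖ ≤ bound i w) :
    ContDiff ℝ m (fun x => ∫ w, N w x ∂μ) ∧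
      ∀ j ≤ m, ∀ x, iteratedFDeriv ℝ j (fun x => ∫ w, N w x ∂μ) x =
        ∫ w, iteratedFDeriv ℝ j (N w) x ∂μ := by
  -- the candidate derivatives
  let B : (i : ℕ) → E → E [×i]→L[ℝ] F := fun i x => ∫ w, iteratedFDeriv ℝ i (N w) x ∂μ
  let L : (i : ℕ) → (E [×(i + 1)]→L[ℝ] F) ≃ₗᵢ[ℝ] (E →L[ℝ] E [×i]→L[ℝ] F) := fun i =>
    continuousMultilinearCurryLeftEquiv ℝ (fun _ : Fin (i + 1) => E) F
  have hmeas : ∀ i x, AEStronglyMeasurable (fun w => iteratedFDeriv ℝ i (N w) x) μ := fun i x =>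
    ((stronglyMeasurable_iteratedFDeriv_param hN hs i).comp_measurable
      (measurable_id.prodMk measurable_const)).aestronglyMeasurable
  have hint : ∀ i ≤ m, ∀ x, Integrable (fun w => iteratedFDeriv ℝ i (N w) x) μ := fun i hi x =>
    (hbi i hi).mono' (hmeas i x) (Eventually.of_forall fun w => hb i hi w x)
  -- one derivative under the integral sign
  have hQ : ∀ i, i + 1 ≤ m → ∀ x, HasFDerivAt (B i) (L i (B (i + 1) x)) x := by
    intro i hi x
    have hi' : i ≤ m := (Nat.le_succ i).trans hi
    have hdiff : ∀ w y, HasFDerivAt (fun y => iteratedFDeriv ℝ i (N w) y)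
        (fderiv ℝ (iteratedFDeriv ℝ i (N w)) y) y := fun w y =>
      (((hs w).differentiable_iteratedFDeriv (m := i) (by exact_mod_cast ENat.coe_lt_top i)) y)
        |>.hasFDerivAt
    have hF'm : AEStronglyMeasurable (fun w => fderiv ℝ (iteratedFDeriv ℝ i (N w)) x) μ := by
      have : (fun w => fderiv ℝ (iteratedFDeriv ℝ i (N w)) x) =
          fun w => L i (iteratedFDeriv ℝ (i + 1) (N w) x) := by
        funext w; rfl
      rw [this]
      exact (L i).continuous.comp_aestronglyMeasurable (hmeas (i + 1) x)
    have h := hasFDerivAt_integral_of_dominated_of_fderiv_le (μ := μ)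
      (F := fun y w => iteratedFDeriv ℝ i (N w) y)
      (F' := fun y w => fderiv ℝ (iteratedFDeriv ℝ i (N w)) y) (bound := bound (i + 1))
      (ball_mem_nhds x zero_lt_one) (Eventually.of_forall fun y => hmeas i y) (hint i hi' x) hF'm
      (Eventually.of_forall fun w y _ => by
        rw [norm_fderiv_iteratedFDeriv]; exact hb (i + 1) hi w y)
      (hbi (i + 1) hi) (Eventually.of_forall fun w y _ => hdiff w y)
    have hval : (∫ w, fderiv ℝ (iteratedFDeriv ℝ i (N w)) x ∂μ) = L i (B (i + 1) x) := by
      show (∫ w, (L i).toLinearIsometry (iteratedFDeriv ℝ (i + 1) (N w) x) ∂μ) = _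
      exact LinearIsometry.integral_comp_comm (X := Ω) (μ := μ) (𝕜 := ℝ) (E := E [×(i + 1)]→L[ℝ] F)
        (F := E →L[ℝ] E [×i]→L[ℝ] F) (L i).toLinearIsometry _
    rwa [hval] at h
  -- continuity of every `B i`, `i ≤ m`
  have hcont : ∀ i ≤ m, Continuous (B i) := fun i hi =>
    continuous_of_dominated (fun x => hmeas i x) (fun x => Eventually.of_forall fun w => hb i hi w x)
      (hbi i hi) (Eventually.of_forall fun w =>
        (hs w).continuous_iteratedFDeriv (m := i) (by exact_mod_cast le_top))
  -- `B i ∈ C^j` whenever `i + j ≤ m`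
  have hS : ∀ j i, i + j ≤ m → ContDiff ℝ j (B i) := by
    intro j
    induction j with
    | zero => intro i hi; exact contDiff_zero.2 (hcont i (by omega))
    | succ j ih =>
      intro i hi
      have hi1 : i + 1 ≤ m := by omega
      have hd : ∀ x, HasFDerivAt (B i) (L i (B (i + 1) x)) x := hQ i hi1
      have hfd : fderiv ℝ (B i) = fun x => L i (B (i + 1) x) := funext fun x => (hd x).fderiv
      rw [show ((j + 1 : ℕ) : WithTop ℕ∞) = (j : WithTop ℕ∞) + 1 by push_cast; ring,
        contDiff_succ_iff_fderiv]
      refine ⟨fun x => (hd x).differentiableAt, fun h => absurd h (by simp), ?_⟩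
      rw [hfd]
      exact (LinearIsometryEquiv.contDiff (E := E [×(i + 1)]→L[ℝ] F)
        (F := E →L[ℝ] E [×i]→L[ℝ] F) (L i)).comp (ih (i + 1) (by omega))
  -- the integral itself
  have hf : (fun x => ∫ w, N w x ∂μ) = fun x => (continuousMultilinearCurryFin0 ℝ E F) (B 0 x) := by
    funext x
    have : B 0 x = ∫ w, (continuousMultilinearCurryFin0 ℝ E F).symm.toLinearIsometry (N w x) ∂μ :=
      rfl
    rw [this, LinearIsometry.integral_comp_comm (X := Ω) (μ := μ) (𝕜 := ℝ) (E := F)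
      (F := E [×0]→L[ℝ] F)]
    simp
  have hR : ∀ j ≤ m, iteratedFDeriv ℝ j (fun x => ∫ w, N w x ∂μ) = B j := by
    intro j
    induction j with
    | zero =>
      intro _
      funext x
      rw [iteratedFDeriv_zero_eq_comp, Function.comp_apply,
        show (∫ w, N w x ∂μ) = continuousMultilinearCurryFin0 ℝ E F (B 0 x) from congrFun hf x]
      simp
    | succ j ih =>
      intro hj
      have hfd : fderiv ℝ (B j) = fun x => L j (B (j + 1) x) :=
        funext fun x => (hQ j hj x).fderiv
      rw [iteratedFDeriv_succ_eq_comp_left, ih ((Nat.le_succ j).trans hj), hfd]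
      funext x
      simp only [Function.comp_apply, L, LinearIsometryEquiv.symm_apply_apply]
  refine ⟨?_, fun j hj x => by rw [hR j hj]⟩
  rw [hf]
  exact (LinearIsometryEquiv.contDiff (E := E [×0]→L[ℝ] F) (F := F)
    (continuousMultilinearCurryFin0 ℝ E F)).comp (hS m 0 (by omega))

/-- **Sup bounds pass under the integral**: under the hypotheses of
`contDiff_integral_of_dominated_iteratedFDeriv`, `‖Dʲ(∫ N w · dμ)(x)‖ ≤ ∫ bⱼ dμ` for `j ≤ m`.
[folklore] -/
theorem norm_iteratedFDeriv_integral_le {N : Ω → E → F} {m : ℕ}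
    (hN : StronglyMeasurable (uncurry N)) (hs : ∀ w, ContDiff ℝ ∞ (N w))
    {bound : ℕ → Ω → ℝ} (hbi : ∀ i ≤ m, Integrable (bound i) μ)
    (hb : ∀ i ≤ m, ∀ w x, ‖iteratedFDeriv ℝ i (N w) x‖ ≤ bound i w) {j : ℕ} (hj : j ≤ m) (x : E) :
    ‖iteratedFDeriv ℝ j (fun x => ∫ w, N w x ∂μ) x‖ ≤ ∫ w, bound j w ∂μ := by
  rw [(contDiff_integral_of_dominated_iteratedFDeriv hN hs hbi hb).2 j hj x]
  exact norm_integral_le_of_norm_le (hbi j hj) (Eventually.of_forall fun w => hb j hj w x)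

/-- **Increments pass under the integral**: under the hypotheses of
`contDiff_integral_of_dominated_iteratedFDeriv`, if `‖Dʲ(N w)(x) − Dʲ(N w)(y)‖ ≤ c(w)` with `c`
integrable, then `‖Dʲ(∫N)(x) − Dʲ(∫N)(y)‖ ≤ ∫ c dμ` (`j ≤ m`; used with the interpolated
Hölder majorant). [folklore] -/
theorem norm_iteratedFDeriv_integral_sub_le {N : Ω → E → F} {m : ℕ}
    (hN : StronglyMeasurable (uncurry N)) (hs : ∀ w, ContDiff ℝ ∞ (N w))
    {bound : ℕ → Ω → ℝ} (hbi : ∀ i ≤ m, Integrable (bound i) μ)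
    (hb : ∀ i ≤ m, ∀ w x, ‖iteratedFDeriv ℝ i (N w) x‖ ≤ bound i w) {j : ℕ} (hj : j ≤ m) {x y : E}
    {c : Ω → ℝ} (hci : Integrable c μ)
    (hc : ∀ w, ‖iteratedFDeriv ℝ j (N w) x - iteratedFDeriv ℝ j (N w) y‖ ≤ c w) :
    ‖iteratedFDeriv ℝ j (fun x => ∫ w, N w x ∂μ) x - iteratedFDeriv ℝ j (fun x => ∫ w, N w x ∂μ) y‖ ≤
      ∫ w, c w ∂μ := by
  have h := contDiff_integral_of_dominated_iteratedFDeriv hN hs hbi hb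
  have hmeas : ∀ z, AEStronglyMeasurable (fun w => iteratedFDeriv ℝ j (N w) z) μ := fun z =>
    ((stronglyMeasurable_iteratedFDeriv_param hN hs j).comp_measurable
      (measurable_id.prodMk measurable_const)).aestronglyMeasurable
  have hint : ∀ z, Integrable (fun w => iteratedFDeriv ℝ j (N w) z) μ := fun z =>
    (hbi j hj).mono' (hmeas z) (Eventually.of_forall fun w => hb j hj w z)
  rw [h.2 j hj x, h.2 j hj y, ← integral_sub (hint x) (hint y)]
  exact norm_integral_le_of_norm_le hci (Eventually.of_forall hc)

end Dominated

end Literature.Analysis.FunctionSpaces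

end
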